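import Literature.NumberTheory.Rogawski1990.UnipotentOrbitCoveringRegularCM             -- ★ p849367 (this seat): (I) `UnitaryGroup.exists_cover_of_regular_basePoint`; brings the frame, REG-FRAME, Iwasawa, ★ p849314
import Literature.NumberTheory.Automorphic.ValuationBallStableSubgroupIndex            -- ★ LH5-p02 (g2) BALL-INDEX: `relIndex_leAddSubgroup_inf_ne_zero` (the balls `B_F(n)` are commensurable)
import HarnessLib

/-!
# SHELL COVERING at the regular unipotent base point of `U(Φ₃)(L⁺_v)`: `{y ∣ y γ₀ y⁻¹ ∈ C} ⊆ ⋃_{j ≥ j₀} ⋃_{q < N_j} K · x_{j,q} · C(γ₀)` with `N_j` the ball index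
# `[B_F(r+2j−e) : B_F(j−e)]` on the `σ_w`-fixed line (Ranga Rao's theorem for `U(3)`, regular class, step (II-C))

Topic `NumberTheory/Rogawski1990`; namespace `Literature.NumberTheory.Rogawski1990`.  THEOREMS ONLY (no definition, no instance, no notation, no named fact, no `sorry`);
MEASURE-FREE.  Cell `pub/hodgecm-mathlib` (D-0151), crux H413 = `stmt-HodgeConjecture-24833`, F0∕P3c line LH4 (Shalika pay-down), organ RAO-CONV, REGULAR class; cut of
LH4-plan (g2) DEALER WORDS #43 (2026-09-02): (I) ★ p849367 covering (this seat) → (II-C) THIS FILE (this seat) → (II-E) LH5-p02 (g2) shell data + the 7 clauses → (III)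
LH4-p03 (g3) generic shell sum → (IV) LH7-p01 (g2) regular-case file of record.

THE MATHEMATICS.  Notation of ★ (I) (`ψ = e`, `K = U(Φ₃)(𝒪_v)`, uniformiser `z`, skew `ξ ≠ 0` with `|ξ| = exp e`, `d = diag(z, 1, (σz)⁻¹)`, regular base point
`ψγ₀ = u₀ = !![1,1,−t₀;0,1,−1;0,0,1]`, so `t₀ + σt₀ = 1`), `F = {κ ∣ σκ = κ}` the σ-fixed line, `B_F(n) = {κ ∈ F ∣ |κ| ≤ exp n}` (★ `Valuation.leAddSubgroup ⊓ F`),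
`m_κ` the one-parameter transversal and `n(a,s)` the centraliser coordinates of ★ REG-FRAME.  From ★ (I): `y = k·y₁`, `ψy₁ = d^j m_κ n(a,s)`, `−R₁ ≤ j`,
`|t₀ + 2κξ| ≤ exp(R₂ + 2j)`.  Put `κ₀ := (t₀ − 2⁻¹)∕(2ξ) ∈ F`; then `t₀ + 2κξ = 2⁻¹ + 2ξ(κ + κ₀)` is FIXED + SKEW, and at an odd place the skew part is dominated:
`2·2ξ(κ+κ₀) = X − σX` for `X = t₀ + 2κξ`, so `|κ + κ₀| ≤ exp(R₂ + 2j − e)`, i.e. `κ + κ₀ ∈ B_F(r + 2j − e)` (`r = max R₁ R₂`).  The quotient `B_F(r+2j−e) ⧸ B_F(j−e)` is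
finite (★ BALL-INDEX `relIndex_leAddSubgroup_inf_ne_zero`), of order `N_j`; enumerate representatives `κ_{j,q}` (`q < N_j`) and put `x_{j,q} := ψ⁻¹(d^j · m_{κ_{j,q} − κ₀})`.
ABSORPTION: `κ = κ′ + (κ_{j,q} − κ₀)` with `κ′ ∈ B_F(j−e)`, `m_κ = m_{κ′} m_{κ_{j,q}−κ₀}` (★ `coe_transversal_mul`), and
`d^j m_κ n(a,s) = (d^j m_{κ′} d^{−j}) · ψ(x_{j,q}) · n(a,s)` with `d^j m_{κ′} d^{−j}` INTEGRAL (★ `isIntMatrix_torusZpow_conj_transversal_iff`: `|z^j κ′ ξ| ≤ exp(−j + j − e + e) = 1`)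
and `n(a,s) ∈ ψ(C(γ₀))` (★ `regCentElt_mem_and_commute`) — hence `y ∈ K · x_{j,q} · C(γ₀)`.

* `UnitaryGroup.exists_shellCover_of_regular_basePoint` — THE EXPORT (II-C) (statement line 05:08Z, LH4 bus).
HONEST LABEL: count-neutral ★ brick (`--supports stmt-HodgeConjecture-24833`); HC_CM is proved only modulo the 7 printed citations (2 remaining: hLiu418 =
stmt-HodgeConjecture-24832, h413 = stmt-HodgeConjecture-24833) until rung 0 closes.

## References
* [Rao1972] R. Ranga Rao, *Orbital integrals in reductive groups*, Ann. of Math. (2) 96 (1972) 505–510, Theorem p. 505.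
* [Rogawski1990] J. D. Rogawski, *Automorphic Representations of Unitary Groups in Three Variables*, Ann. of Math. Stud. 123 (1990): §1.10 p. 9, §3.9 Prop. 3.9.1 p. 32, §4.9 p. 54,
  §8.1 p. 112.
* [Serre1979] J.-P. Serre, *Local Fields*, GTM 67 (1979), Ch. II §3 (the balls of a discretely valued field are commensurable).
-/

set_option autoImplicit false

noncomputable section

open scoped Matrix MatrixGroups WithZero ValuativeRel Pointwise
open Matrix Topology Set NumberField IsDedekindDomain

namespace Literature.NumberTheory.Rogawski1990

open Literature.NumberTheory.Automorphic Literature.NumberTheory.Automorphic.UnitaryGroup Literature.NumberTheory.GaloisRepresentations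
open Literature.NumberTheory.Automorphic.UnitaryLatticeTree Literature.NumberTheory.Automorphic.HermitianLattice

set_option maxHeartbeats 3200000 in
/-- **SHELL COVERING AT THE REGULAR BASE POINT (RAO-CONV, regular class, step (II-C)).**  In the frame of ★ (I): with `|ξ| = exp e`, `r := max R₁ R₂`, `j₀ := −r`,
`N j := [B_F(r+2j−e) : B_F(j−e)]` (the ball index on the σ-fixed line `F`, ★ BALL-INDEX) and shell elements `x j q` with `ψ(x j q) = d^j · m_κ` (`κ` σ-fixed), every `y`
with `y γ₀ y⁻¹ ∈ C` lies in `K · x j q · C(γ₀)` for some `j ≥ j₀`, `q < N j`. [cite: Rao1972, Theorem p. 505] [cite: Rogawski1990, §3.9 Prop. 3.9.1 p. 32; §8.1 p. 112]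
[cite: Serre1979, Ch. II §3] -/
theorem UnitaryGroup.exists_shellCover_of_regular_basePoint
    (L : Type) [Field L] [NumberField L] [IsCMField L] (v : HeightOneSpectrum (𝓞 ↥(maximalRealSubfield L)))
    (w : PlacesOver L v) (hw : IsCMField.complexConj L • w.1 = w.1) (h2 : IsUnit (2 : 𝒪[w.1.adicCompletion L]))
    {z ξ t₀ : (w.1.adicCompletion L)} (hz : Valued.v z = WithZero.exp (-1 : ℤ)) (hξ : (galAdicCompletionMap (L := L) (IsCMField.complexConj L) hw) ξ = -ξ) (hξ0 : ξ ≠ 0)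
    {d : GL (Fin 3) (w.1.adicCompletion L)} (hd : (d : Matrix (Fin 3) (Fin 3) (w.1.adicCompletion L)) = Matrix.diagonal ![z, 1, ((galAdicCompletionMap (L := L) (IsCMField.complexConj L) hw) z)⁻¹])
    (γ₀ : ((cmDatum L 3 (Matrix.of fun i j : Fin 3 => if i.val + j.val + 1 = 3 then (1 : L) else 0)).Local v)) (hγ₀ : (((localNonsplitEquiv (IsCMField.complexConj L) (Matrix.of fun i j : Fin 3 => if i.val + j.val + 1 = 3 then (1 : L) else 0) (IsCMField.complexConj_ne_one L) w hw γ₀ : ↥(unitaryGroupOfForm (galAdicCompletionMap (L := L) (IsCMField.complexConj L) hw) (placeForm (Matrix.of fun i j : Fin 3 => if i.val + j.val + 1 = 3 then (1 : L) else 0) w.1))) : GL (Fin 3) (w.1.adicCompletion L)) : Matrix (Fin 3) (Fin 3) (w.1.adicCompletion L)) = !![1, 1, -t₀; 0, 1, -1; 0, 0, 1])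
    (C : Set ((cmDatum L 3 (Matrix.of fun i j : Fin 3 => if i.val + j.val + 1 = 3 then (1 : L) else 0)).Local v)) (hC : IsCompact C) :
    ∃ (e j₀ r : ℤ) (N : ℤ → ℕ) (x : ℤ → ℕ → ((cmDatum L 3 (Matrix.of fun i j : Fin 3 => if i.val + j.val + 1 = 3 then (1 : L) else 0)).Local v)),
      Valued.v ξ = WithZero.exp e ∧ j₀ = -r ∧
      (∀ j : ℤ, N j = ((Valued.v : Valuation (w.1.adicCompletion L) ℤᵐ⁰).leAddSubgroup (WithZero.exp (j - e)) ⊓ (AddMonoidHom.id (w.1.adicCompletion L) - (galAdicCompletionMap (L := L) (IsCMField.complexConj L) hw : (w.1.adicCompletion L) →+* (w.1.adicCompletion L)).toAddMonoidHom).ker).relIndex ((Valued.v : Valuation (w.1.adicCompletion L) ℤᵐ⁰).leAddSubgroup (WithZero.exp (r + 2 * j - e)) ⊓ (AddMonoidHom.id (w.1.adicCompletion L) - (galAdicCompletionMap (L := L) (IsCMField.complexConj L) hw : (w.1.adicCompletion L) →+* (w.1.adicCompletion L)).toAddMonoidHom).ker)) ∧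
      (∀ (j : ℤ) (q : ℕ), q < N j → ∃ κ : (w.1.adicCompletion L), (galAdicCompletionMap (L := L) (IsCMField.complexConj L) hw) κ = κ ∧ ∃ m : GL (Fin 3) (w.1.adicCompletion L),
        (m : Matrix (Fin 3) (Fin 3) (w.1.adicCompletion L)) = !![1, κ * ξ, κ ^ 2 * ξ ^ 2 / 2; 0, 1, κ * ξ; 0, 0, 1] ∧ ((localNonsplitEquiv (IsCMField.complexConj L) (Matrix.of fun i j : Fin 3 => if i.val + j.val + 1 = 3 then (1 : L) else 0) (IsCMField.complexConj_ne_one L) w hw (x j q) : ↥(unitaryGroupOfForm (galAdicCompletionMap (L := L) (IsCMField.complexConj L) hw) (placeForm (Matrix.of fun i j : Fin 3 => if i.val + j.val + 1 = 3 then (1 : L) else 0) w.1))) : GL (Fin 3) (w.1.adicCompletion L)) = d ^ j * m) ∧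
      ∀ y : ((cmDatum L 3 (Matrix.of fun i j : Fin 3 => if i.val + j.val + 1 = 3 then (1 : L) else 0)).Local v), y * γ₀ * y⁻¹ ∈ C → ∃ j : ℤ, j₀ ≤ j ∧ ∃ q : ℕ, q < N j ∧
        y ∈ (cmLocalIntegralLevel L 3 (Matrix.of fun i j : Fin 3 => if i.val + j.val + 1 = 3 then (1 : L) else 0) v : Set ((cmDatum L 3 (Matrix.of fun i j : Fin 3 => if i.val + j.val + 1 = 3 then (1 : L) else 0)).Local v)) * {x j q} * (Subgroup.centralizer ({γ₀} : Set ((cmDatum L 3 (Matrix.of fun i j : Fin 3 => if i.val + j.val + 1 = 3 then (1 : L) else 0)).Local v)) : Set ((cmDatum L 3 (Matrix.of fun i j : Fin 3 => if i.val + j.val + 1 = 3 then (1 : L) else 0)).Local v)) := by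
  classical
  -- ## 0. The frame `ψ = e` and its dictionary (as in ★ p849314 ∕ ★ p849367)
  have hT : placeForm (Matrix.of fun i j : Fin 3 => if i.val + j.val + 1 = 3 then (1 : L) else 0) w.1 = formCongr (galAdicCompletionMap (L := L) (IsCMField.complexConj L) hw) (1 : GL (Fin 3) (w.1.adicCompletion L)) ((StdForm.antidiagonal 3).over (w.1.adicCompletion L)) := by
    rw [placeForm_antidiagOne]; simp [formCongr, Matrix.map_one]
  have hTint : (1 : GL (Fin 3) (w.1.adicCompletion L)) ∈ glInt 3 (w.1.adicCompletion L) := Subgroup.one_mem _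
  obtain ⟨ψ, hψ⟩ : ∃ ψ : ((cmDatum L 3 (Matrix.of fun i j : Fin 3 => if i.val + j.val + 1 = 3 then (1 : L) else 0)).Local v) → GL (Fin 3) (w.1.adicCompletion L), ∀ y, ψ y = 1 * ((localNonsplitEquiv (IsCMField.complexConj L) (Matrix.of fun i j : Fin 3 => if i.val + j.val + 1 = 3 then (1 : L) else 0) (IsCMField.complexConj_ne_one L) w hw y : ↥(unitaryGroupOfForm (galAdicCompletionMap (L := L) (IsCMField.complexConj L) hw) (placeForm (Matrix.of fun i j : Fin 3 => if i.val + j.val + 1 = 3 then (1 : L) else 0) w.1))) : GL (Fin 3) (w.1.adicCompletion L)) * 1⁻¹ := ⟨_, fun _ => rfl⟩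
  have hψe : ∀ y, ψ y = ((localNonsplitEquiv (IsCMField.complexConj L) (Matrix.of fun i j : Fin 3 => if i.val + j.val + 1 = 3 then (1 : L) else 0) (IsCMField.complexConj_ne_one L) w hw y : ↥(unitaryGroupOfForm (galAdicCompletionMap (L := L) (IsCMField.complexConj L) hw) (placeForm (Matrix.of fun i j : Fin 3 => if i.val + j.val + 1 = 3 then (1 : L) else 0) w.1))) : GL (Fin 3) (w.1.adicCompletion L)) := fun y => by rw [hψ, one_mul, inv_one, mul_one]
  have hψU : ∀ y, ψ y ∈ unitaryGroupOfForm (galAdicCompletionMap (L := L) (IsCMField.complexConj L) hw) ((StdForm.antidiagonal 3).over (w.1.adicCompletion L)) :=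
    fun y => by rw [hψ]; exact conj_localNonsplitEquiv_mem L _ v w hw hT y
  have hψmul : ∀ y y', ψ (y * y') = ψ y * ψ y' := fun y y' => by simp only [hψ]; exact conj_localNonsplitEquiv_mul L _ v w hw y y'
  have hψsurj : ∀ g ∈ unitaryGroupOfForm (galAdicCompletionMap (L := L) (IsCMField.complexConj L) hw) ((StdForm.antidiagonal 3).over (w.1.adicCompletion L)), ∃ y, ψ y = g :=
    fun g hg => by simp only [hψ]; exact exists_conj_localNonsplitEquiv_eq L _ v w hw hT hg
  have hψK : ∀ y, y ∈ cmLocalIntegralLevel L 3 (Matrix.of fun i j : Fin 3 => if i.val + j.val + 1 = 3 then (1 : L) else 0) v ↔ IsIntMatrix ((ψ y : GL (Fin 3) (w.1.adicCompletion L)) : Matrix (Fin 3) (Fin 3) (w.1.adicCompletion L)) :=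
    fun y => by rw [hψ]; exact mem_cmLocalIntegralLevel_iff_isIntMatrix_conj L _ v w hw hT hTint y
  have hψinj : ∀ y y', ψ y = ψ y' → y = y' := fun y y' h => by
    rw [hψ, hψ] at h; exact conj_localNonsplitEquiv_injective L _ v w hw h
  have hψγ₀ : ((ψ γ₀ : GL (Fin 3) (w.1.adicCompletion L)) : Matrix (Fin 3) (Fin 3) (w.1.adicCompletion L)) = !![1, 1, -t₀; 0, 1, -1; 0, 0, 1] := by rw [hψe]; exact hγ₀
  -- the local field data
  have hcc : IsCMField.complexConj L * IsCMField.complexConj L = 1 := AlgEquiv.ext fun y => IsCMField.complexConj_apply_apply L y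
  have hσσ : ∀ x : (w.1.adicCompletion L), (galAdicCompletionMap (L := L) (IsCMField.complexConj L) hw) ((galAdicCompletionMap (L := L) (IsCMField.complexConj L) hw) x) = x :=
    fun x => Literature.NumberTheory.Automorphic.Liu2021.galAdicCompletionMap_galAdicCompletionMap_self _ L (IsCMField.complexConj L) hcc hw x
  have hvσ : ∀ x : (w.1.adicCompletion L), Valued.v ((galAdicCompletionMap (L := L) (IsCMField.complexConj L) hw) x) = Valued.v x := fun x => valued_galAdicCompletionMap (L := L) (IsCMField.complexConj L) hw x
  have hv2 : Valued.v (2 : (w.1.adicCompletion L)) = 1 := by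
    have h := h2
    rw [Valuation.Integers.isUnit_iff_valuation_eq_one (Valuation.integer.integers (ValuativeRel.valuation (w.1.adicCompletion L))),
      (ValuativeRel.isEquiv (ValuativeRel.valuation (w.1.adicCompletion L)) (Valued.v : Valuation (w.1.adicCompletion L) _)).eq_one_iff_eq_one] at h
    exact h
  have h2K : (2 : (w.1.adicCompletion L)) ≠ 0 := fun h => by rw [h, map_zero] at hv2; exact zero_ne_one hv2
  have hz0 : z ≠ 0 := fun h => by rw [h, map_zero] at hz; exact WithZero.exp_ne_zero hz.symm
  have hdU : d ∈ unitaryGroupOfForm (galAdicCompletionMap (L := L) (IsCMField.complexConj L) hw) ((StdForm.antidiagonal 3).over (w.1.adicCompletion L)) := torusElt_mem_unitaryGroupOfForm (galAdicCompletionMap (L := L) (IsCMField.complexConj L) hw) hz0 (hσσ z) hd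
  have hexp_of_ne : ∀ {x : (w.1.adicCompletion L)}, x ≠ 0 → ∃ n : ℤ, Valued.v x = WithZero.exp n := fun {x} hx => by
    have h0 : Valued.v x ≠ 0 := (Valuation.ne_zero_iff _).2 hx
    obtain ⟨e, he⟩ := WithZero.ne_zero_iff_exists.1 h0
    exact ⟨Multiplicative.toAdd e, by rw [← he]; rfl⟩
  obtain ⟨e, he⟩ := hexp_of_ne hξ0
  -- `t₀ + σ t₀ = 1` (unitarity of `u₀`) and the σ-fixed shift `κ₀ = (t₀ − 2⁻¹)∕(2ξ)`
  have ht₀ : t₀ + (galAdicCompletionMap (L := L) (IsCMField.complexConj L) hw) t₀ = 1 := by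
    obtain ⟨-, h⟩ := (mem_unitaryGroupOfForm_iff_of_coe_eq_upperUnipotent (galAdicCompletionMap (L := L) (IsCMField.complexConj L) hw) hσσ hψγ₀).1 (hψU γ₀)
    rw [map_neg, map_one, mul_one] at h
    linear_combination -h
  obtain ⟨κ₀, hκ₀⟩ : ∃ κ₀ : (w.1.adicCompletion L), κ₀ = (t₀ - 2⁻¹) / (2 * ξ) := ⟨_, rfl⟩
  have hσ2 : (galAdicCompletionMap (L := L) (IsCMField.complexConj L) hw) (2 : (w.1.adicCompletion L))⁻¹ = 2⁻¹ := by rw [map_inv₀, map_ofNat]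
  have hσκ₀ : (galAdicCompletionMap (L := L) (IsCMField.complexConj L) hw) κ₀ = κ₀ := by
    rw [hκ₀, map_div₀, map_sub, map_mul, map_ofNat, hσ2, hξ, show (galAdicCompletionMap (L := L) (IsCMField.complexConj L) hw) t₀ = 1 - t₀ by linear_combination ht₀]
    field_simp
    ring
  have hkey : ∀ κ : (w.1.adicCompletion L), 2 * ξ * (κ + κ₀) = (t₀ + 2 * κ * ξ) - 2⁻¹ := by
    intro κ; rw [hκ₀]; field_simp; ring
  -- ## 1. The covering of ★ (I) and the radii
  obtain ⟨R₁, R₂, hcov⟩ := UnitaryGroup.exists_cover_of_regular_basePoint L v w hw h2 hz hξ hξ0 hd γ₀ hγ₀ C hC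
  obtain ⟨r, hr⟩ : ∃ r : ℤ, r = max R₁ R₂ := ⟨_, rfl⟩
  -- ## 2. The balls on the σ-fixed line and their representatives
  obtain ⟨B, hB⟩ : ∃ B : ℤ → AddSubgroup (w.1.adicCompletion L), ∀ n, B n = ((Valued.v : Valuation (w.1.adicCompletion L) ℤᵐ⁰).leAddSubgroup (WithZero.exp (n)) ⊓ (AddMonoidHom.id (w.1.adicCompletion L) - (galAdicCompletionMap (L := L) (IsCMField.complexConj L) hw : (w.1.adicCompletion L) →+* (w.1.adicCompletion L)).toAddMonoidHom).ker) := ⟨_, fun _ => rfl⟩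
  have hmemB : ∀ (n : ℤ) (x : (w.1.adicCompletion L)), x ∈ B n ↔ Valued.v x ≤ WithZero.exp n ∧ (galAdicCompletionMap (L := L) (IsCMField.complexConj L) hw) x = x := by
    intro n x
    rw [hB, AddSubgroup.mem_inf, Valuation.mem_leAddSubgroup_iff, AddMonoidHom.mem_ker, AddMonoidHom.sub_apply, AddMonoidHom.id_apply,
      RingHom.toAddMonoidHom_eq_coe, AddMonoidHom.coe_coe, sub_eq_zero]
    exact ⟨fun ⟨h1, h2⟩ => ⟨h1, h2.symm⟩, fun ⟨h1, h2⟩ => ⟨h1, h2.symm⟩⟩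
  have hNne : ∀ j : ℤ, (B (j - e)).relIndex (B (r + 2 * j - e)) ≠ 0 := fun j => by
    rw [hB, hB]; exact relIndex_leAddSubgroup_inf_ne_zero _ hz (j - e) (r + 2 * j - e)
  have hrep : ∀ j : ℤ, ∃ κs : ℕ → (w.1.adicCompletion L), (∀ q, (galAdicCompletionMap (L := L) (IsCMField.complexConj L) hw) (κs q) = κs q) ∧
      ∀ b ∈ B (r + 2 * j - e), ∃ q, q < (B (j - e)).relIndex (B (r + 2 * j - e)) ∧ b - κs q ∈ B (j - e) := by
    intro j
    -- the finite quotient `B(big) ⧸ B(small)`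
    haveI hfin : Finite (↥(B (r + 2 * j - e)) ⧸ (B (j - e)).addSubgroupOf (B (r + 2 * j - e))) :=
      Nat.finite_of_card_ne_zero (hNne j)
    obtain ⟨eQ⟩ : Nonempty ((↥(B (r + 2 * j - e)) ⧸ (B (j - e)).addSubgroupOf (B (r + 2 * j - e))) ≃
        Fin (Nat.card (↥(B (r + 2 * j - e)) ⧸ (B (j - e)).addSubgroupOf (B (r + 2 * j - e))))) := ⟨Finite.equivFin _⟩
    refine ⟨fun q => if hq : q < Nat.card (↥(B (r + 2 * j - e)) ⧸ (B (j - e)).addSubgroupOf (B (r + 2 * j - e))) then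
        ((eQ.symm ⟨q, hq⟩).out : ↥(B (r + 2 * j - e))) else 0, fun q => ?_, fun b hb => ?_⟩
    · dsimp only
      split_ifs with hq
      · exact ((hmemB _ _).1 ((eQ.symm ⟨q, hq⟩).out).2).2
      · exact map_zero _
    · obtain ⟨bq, hbq⟩ : ∃ bq : ↥(B (r + 2 * j - e)) ⧸ (B (j - e)).addSubgroupOf (B (r + 2 * j - e)),
          bq = ((⟨b, hb⟩ : ↥(B (r + 2 * j - e))) : ↥(B (r + 2 * j - e)) ⧸ (B (j - e)).addSubgroupOf (B (r + 2 * j - e))) := ⟨_, rfl⟩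
      refine ⟨(eQ bq).val, (eQ bq).isLt, ?_⟩
      dsimp only
      rw [dif_pos (eQ bq).isLt, Fin.eta, Equiv.symm_apply_apply]
      have hq : ((bq.out : ↥(B (r + 2 * j - e))) : ↥(B (r + 2 * j - e)) ⧸ (B (j - e)).addSubgroupOf (B (r + 2 * j - e))) =
          ((⟨b, hb⟩ : ↥(B (r + 2 * j - e))) : ↥(B (r + 2 * j - e)) ⧸ (B (j - e)).addSubgroupOf (B (r + 2 * j - e))) := by
        rw [QuotientAddGroup.out_eq', hbq]
      have hmem := QuotientAddGroup.eq.1 hq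
      rw [AddSubgroup.mem_addSubgroupOf, AddSubgroup.coe_add, AddSubgroup.coe_neg] at hmem
      have e' : b - ((bq.out : ↥(B (r + 2 * j - e))) : (w.1.adicCompletion L)) = -((bq.out : ↥(B (r + 2 * j - e))) : (w.1.adicCompletion L)) + b := by ring
      rw [e']
      exact hmem
  choose κs hκσ hκcov using hrep
  -- the shell elements `x j q = ψ⁻¹(d^j · m_{κs j q − κ₀})`
  have hxq : ∀ (j : ℤ) (q : ℕ), ∃ (m : GL (Fin 3) (w.1.adicCompletion L)) (xx : ((cmDatum L 3 (Matrix.of fun i j : Fin 3 => if i.val + j.val + 1 = 3 then (1 : L) else 0)).Local v)),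
      (m : Matrix (Fin 3) (Fin 3) (w.1.adicCompletion L)) = !![1, (κs j q - κ₀) * ξ, (κs j q - κ₀) ^ 2 * ξ ^ 2 / 2; 0, 1, (κs j q - κ₀) * ξ; 0, 0, 1] ∧ ψ xx = d ^ j * m := by
    intro j q
    obtain ⟨m, hm, -⟩ := exists_units_coe_eq_upperTriangularUnipotent ((κs j q - κ₀) * ξ) ((κs j q - κ₀) ^ 2 * ξ ^ 2 / 2) ((κs j q - κ₀) * ξ)
    have hmU := transversal_mem (galAdicCompletionMap (L := L) (IsCMField.complexConj L) hw) hσσ h2K hξ (by rw [map_sub, hκσ, hσκ₀]) hm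
    obtain ⟨xx, hxx⟩ := hψsurj (d ^ j * m) (mul_mem (zpow_mem hdU j) hmU)
    exact ⟨m, xx, hm, hxx⟩
  choose mq x hmq hx using hxq
  -- ## 3. The export
  refine ⟨e, -r, r, fun j => (B (j - e)).relIndex (B (r + 2 * j - e)), x, he, rfl, fun j => by simp only [hB], fun j q _ => ?_, fun y hy => ?_⟩
  · exact ⟨κs j q - κ₀, by rw [map_sub, hκσ, hσκ₀], mq j q, hmq j q, by rw [← hψe]; exact hx j q⟩
  -- ## 4. The covering
  obtain ⟨k, y₁, j, κ, a, s, m, n, hk, hyk, hy₁, hm, hn, hσκ, hσa, hσs, hj, hvt⟩ := hcov y hy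
  rw [← hψe] at hy₁
  refine ⟨j, by rw [hr]; omega, ?_⟩
  -- `κ + κ₀ ∈ B(r + 2j − e)` by the odd-place max principle
  have hvκ : Valued.v (κ + κ₀) ≤ WithZero.exp (r + 2 * j - e) := by
    have hX : 2 * (2 * ξ * (κ + κ₀)) = (t₀ + 2 * κ * ξ) - (galAdicCompletionMap (L := L) (IsCMField.complexConj L) hw) (t₀ + 2 * κ * ξ) := by
      rw [hkey, map_add, map_mul, map_mul, map_ofNat, hσκ, hξ, show (galAdicCompletionMap (L := L) (IsCMField.complexConj L) hw) t₀ = 1 - t₀ by linear_combination ht₀]; ring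
    have hle : Valued.v (2 * (2 * ξ * (κ + κ₀))) ≤ WithZero.exp (R₂ + 2 * j) := by
      rw [hX]
      refine (Valuation.map_sub _ _ _).trans (max_le hvt ?_)
      rw [hvσ]; exact hvt
    rw [map_mul, map_mul, map_mul, hv2, one_mul, one_mul, he] at hle
    have hle' : Valued.v (κ + κ₀) ≤ WithZero.exp (R₂ + 2 * j - e) := by
      have h := mul_le_mul_right hle (WithZero.exp (-e))
      rw [← mul_assoc, ← WithZero.exp_add, neg_add_cancel, WithZero.exp_zero, one_mul, ← WithZero.exp_add] at h
      refine h.trans (le_of_eq ?_); congr 1; ring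
    exact hle'.trans (WithZero.exp_le_exp.2 (by rw [hr]; omega))
  have hκmem : κ + κ₀ ∈ B (r + 2 * j - e) := (hmemB _ _).2 ⟨hvκ, by rw [map_add, hσκ, hσκ₀]⟩
  obtain ⟨q, hq, hκ'⟩ := hκcov j (κ + κ₀) hκmem
  refine ⟨q, hq, ?_⟩
  obtain ⟨hvκ', hσκ'⟩ := (hmemB _ _).1 hκ'
  -- `m = m_{κ′} · m_{κs − κ₀}` with `κ′ = κ + κ₀ − κs j q`
  obtain ⟨m', hm', -⟩ := exists_units_coe_eq_upperTriangularUnipotent ((κ + κ₀ - κs j q) * ξ) ((κ + κ₀ - κs j q) ^ 2 * ξ ^ 2 / 2) ((κ + κ₀ - κs j q) * ξ)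
  have hm'U := transversal_mem (galAdicCompletionMap (L := L) (IsCMField.complexConj L) hw) hσσ h2K hξ hσκ' hm'
  have hmm : m = m' * mq j q := by
    refine Units.ext ?_
    rw [coe_transversal_mul h2K hm' (hmq j q), hm, show κ + κ₀ - κs j q + (κs j q - κ₀) = κ by ring]
  -- `d^j m_{κ′} d^{−j}` is integral
  have hint : IsIntMatrix ((d ^ j * m' * (d ^ j)⁻¹ : GL (Fin 3) (w.1.adicCompletion L)) : Matrix (Fin 3) (Fin 3) (w.1.adicCompletion L)) := by
    rw [isIntMatrix_torusZpow_conj_transversal_iff (galAdicCompletionMap (L := L) (IsCMField.complexConj L) hw) hvσ hv2 hz0 j hd hm', map_mul, map_mul, map_zpow₀, hz, he, ← WithZero.exp_zsmul, smul_eq_mul]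
    calc WithZero.exp (j * (-1 : ℤ)) * (Valued.v (κ + κ₀ - κs j q) * WithZero.exp e)
        ≤ WithZero.exp (j * (-1 : ℤ)) * (WithZero.exp (j - e) * WithZero.exp e) := by gcongr
      _ = 1 := by rw [← WithZero.exp_add, ← WithZero.exp_add, ← WithZero.exp_zero]; congr 1; ring
  obtain ⟨kk, hkk⟩ := hψsurj (d ^ j * m' * (d ^ j)⁻¹) (mul_mem (mul_mem (zpow_mem hdU j) hm'U) (inv_mem (zpow_mem hdU j)))
  have hkkK : kk ∈ cmLocalIntegralLevel L 3 (Matrix.of fun i j : Fin 3 => if i.val + j.val + 1 = 3 then (1 : L) else 0) v := by rw [hψK, hkk]; exact hint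
  -- `n(a,s) ∈ ψ(C(γ₀))`
  obtain ⟨hnU, hncomm⟩ := regCentElt_mem_and_commute (galAdicCompletionMap (L := L) (IsCMField.complexConj L) hw) hσσ h2K hσa hσs hψγ₀ hn
  obtain ⟨nn, hnn⟩ := hψsurj n hnU
  have hnnC : nn ∈ Subgroup.centralizer ({γ₀} : Set ((cmDatum L 3 (Matrix.of fun i j : Fin 3 => if i.val + j.val + 1 = 3 then (1 : L) else 0)).Local v)) := by
    rw [Subgroup.mem_centralizer_singleton_iff]
    exact hψinj _ _ (by rw [hψmul, hψmul, hnn, hncomm])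
  -- `y₁ = kk · x j q · nn`
  have hy₁eq : y₁ = kk * x j q * nn := by
    refine hψinj _ _ ?_
    rw [hy₁, hψmul, hψmul, hkk, hx, hnn, hmm]
    group
  rw [hyk, hy₁eq, show k * (kk * x j q * nn) = (k * kk) * x j q * nn by group]
  exact Set.mul_mem_mul (Set.mul_mem_mul ((cmLocalIntegralLevel L 3 (Matrix.of fun i j : Fin 3 => if i.val + j.val + 1 = 3 then (1 : L) else 0) v).mul_mem hk hkkK) (Set.mem_singleton _)) hnnC

end Literature.NumberTheory.Rogawski1990

end
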